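import Summits.NavierStokesRegularity.NavierStokesRegularity.Theorems.FilamentSkeletonRssDefectColumnGateSectionFrame

/-!
# Route `FilamentSkeletonRss` · crux `TransverseReduction1AL` (stmt-NavierStokesRegularity-23297) · line `defect_column_gate_1AL` —
# SECTIONAL MOMENT IDENTITIES of the 3D class of stub S2a-loc `WaistColumnGateLoc1A` (kinematics only)

Helper file (`--supports stmt-NavierStokesRegularity-23297 --as helper`; LEAD of 23297, lane ns-filament-21221-p1 g12), second of two (tools:
`…DefectColumnGateSectionFrame.lean`).  The stub S2a-loc (`Theorems/FilamentSkeletonRssDefectColumnGateDefs.lean` §7, SAME text on the aside 27853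
and on the live L-twin 23297) quantifies over `C³` solenoidal fields `W : ℝ³ → ℝ³` that VANISH OUTSIDE THE SECTIONAL CYLINDER `|y|² − ⟨y,d⟩² ≥ R²`
about the axis `ℝd` of an orthonormal frame `(d; m, n)`, and asks, at every axial station `τ`, for three moment clauses on the axial vorticity
`ω_d(ξ) = ⟨curl W (secPt d m n τ ξ), d⟩` of the section `ξ ↦ secPt d m n τ ξ = τd + ξ₀m + ξ₁n`: zero sectional mass `∫ ω_d = 0` and zero first
moments `∫ ξ₀ ω_d = ∫ ξ₁ ω_d = 0`.

THIS FILE (pure kinematics: Stokes / integration by parts in the section; no operator, no `Rc`; `ε = ⟨m × n, d⟩ = ±1` the orientation sign of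
the frame, `ε² = 1`):

* `inner_curl_axis_secPt`, `sectional_moment_eq` — `ω_d = ε (∂₀⟨n, W∘secPt⟩ − ∂₁⟨m, W∘secPt⟩)` and the master identity
  `∫ p ω_d = ε (−∫ (∂₀p)⟨n,W⟩ + ∫ (∂₁p)⟨m,W⟩)` for `C¹` weights `p`;
* **`axialVorticity_sectionalMass_eq_zero`** — the MASS clause of `WaistColumnGateLoc1A` is AUTOMATIC: `∫ ω_d dξ = 0` for every `C¹` field vanishing outside
  the cylinder, at every station;
* **`sectional_dipole₀` / `sectional_dipole₁` / `sectional_dipole_iff`** — `∫ ξ₀ ω_d = −ε ∫⟨n, W⟩`, `∫ ξ₁ ω_d = ε ∫⟨m, W⟩`: the two DIPOLE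
  clauses hold iff the SECTIONAL MOMENTUM `(∫⟨m,W⟩, ∫⟨n,W⟩)` vanishes — the natural form for the vector-potential cut-offs of S2b-loc;
* **`sectional_quadrupole_xy` / `sectional_quadrupole_xxyy`** and, for SOLENOIDAL `W` (`inner_fderiv_axis_eq_of_isDivFree`:
  `⟨d,DW d⟩ = −⟨m,DW m⟩ − ⟨n,DW n⟩`, `sectional_axialMoment_eq`), **`sectional_quadrupole_xxyy_eq_axial` / `sectional_quadrupole_xy_eq_axial`**
  — the QUADRUPOLE moments of `ω_d` are second moments of the AXIAL DERIVATIVE OF THE AXIAL VELOCITY: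
  `ε ∫ (ξ₀² − ξ₁²) ω_d = −2 ∫ ξ₀ξ₁ ⟨d, DW(y) d⟩ dξ`, `ε ∫ ξ₀ξ₁ ω_d = ½ ∫ (ξ₀² − ξ₁²) ⟨d, DW(y) d⟩ dξ`;
* `sectional_quadrupole_eq_zero_of_axial` — for AXIALLY FROZEN `W` (`DW(y) d = 0` on the section) both quadrupole moments vanish: the m = 2
  case of the «multipole lever» `exterior_multipole_eq_zero` of `Theorems/…DefectColumnGateMultipole.lean` (p664511, horizontal axially constant
  fields) in frame-free 3D form.

LEAD READING (briefs v6 (R2) of the line): in the stub's 3D class the quadrupole (and higher) sectional moments of `ω_d` are `τ`-DERIVATIVES of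
`W_d`-moments — they have a bounded axial primitive but need NOT vanish — so a proof of S2a-loc uniform over the three-sink sub-box (V1 scan of
ns-filament-s2aloc-p1: slow zero-mass exchange modes with non-zero quadrupole) cannot cite multipole vanishing beyond order 1; it has to carry
the axial-streak bookkeeping (the streak `W_d` is charged by the `κ + 3/2` damping of the operator and the axial log-window is `≤ log Rc`,
which keeps the exchange route polynomial: memo LEAD-NOTES-23297-g12).

HONEST FRAMING: elementary identities about the KINEMATIC class of ONE linear MODEL operator of a hypothetical blow-up route (MODEL rung, negative
side); `WaistColumnGateLoc1A` and `TransverseReduction1AL` are neither proved nor refuted; nothing here bears on Navier–Stokes regularity.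
-/

set_option linter.dupNamespace false

noncomputable section

namespace Summit.NavierStokesRegularity.NavierStokesRegularity.Theorems.DefectColumnGate

open scoped BigOperators InnerProductSpace
open MeasureTheory Set Function
open Literature.Analysis.FluidPDE

/-! ## 4. The sectional moments of the axial vorticity -/

section Moments

variable {d m n : EuclideanSpace ℝ (Fin 3)} {W : EuclideanSpace ℝ (Fin 3) → EuclideanSpace ℝ (Fin 3)} {R : ℝ}

/-- A polynomially weighted scalar component along the section is integrable (continuous with compact support). -/
theorem integrable_mul_inner_comp_secPt (hon : Orthonormal ℝ ![d, m, n]) (hW : ContDiff ℝ 1 W)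
    (hsupp : ∀ y, R ^ 2 ≤ ‖y‖ ^ 2 - ⟪y, d⟫_ℝ ^ 2 → W y = 0) (u : EuclideanSpace ℝ (Fin 3)) (τ : ℝ)
    {q : EuclideanSpace ℝ (Fin 2) → ℝ} (hq : Continuous q) :
    Integrable (fun ξ : EuclideanSpace ℝ (Fin 2) => q ξ * ⟪u, W (secPt d m n τ ξ)⟫_ℝ) :=
  (hq.mul (contDiff_inner_comp_secPt hW u d m n τ).continuous).integrable_of_hasCompactSupport
    (hasCompactSupport_inner_comp_secPt hon hsupp u τ).mul_left

/-- A polynomially weighted sectional derivative of a scalar component is integrable. -/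
theorem integrable_mul_fderiv_inner_comp_secPt (hon : Orthonormal ℝ ![d, m, n]) (hW : ContDiff ℝ 1 W)
    (hsupp : ∀ y, R ^ 2 ≤ ‖y‖ ^ 2 - ⟪y, d⟫_ℝ ^ 2 → W y = 0) (u : EuclideanSpace ℝ (Fin 3)) (τ : ℝ)
    {q : EuclideanSpace ℝ (Fin 2) → ℝ} (hq : Continuous q) (v : EuclideanSpace ℝ (Fin 2)) :
    Integrable (fun ξ : EuclideanSpace ℝ (Fin 2) =>
      q ξ * fderiv ℝ (fun ξ : EuclideanSpace ℝ (Fin 2) => ⟪u, W (secPt d m n τ ξ)⟫_ℝ) ξ v) :=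
  (hq.mul (((contDiff_inner_comp_secPt hW u d m n τ).continuous_fderiv one_ne_zero).clm_apply
    continuous_const)).integrable_of_hasCompactSupport
      (((hasCompactSupport_inner_comp_secPt hon hsupp u τ).fderiv_apply (𝕜 := ℝ) v).mul_left)

/-- **The axial vorticity along the section as a sectional divergence**:
`ω_d(ξ) = ε (∂₀⟨n, W∘secPt⟩ − ∂₁⟨m, W∘secPt⟩)(ξ)`. -/
theorem inner_curl_axis_secPt (hon : Orthonormal ℝ ![d, m, n]) (hW : ContDiff ℝ 1 W) (τ : ℝ) (ξ : EuclideanSpace ℝ (Fin 2)) :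
    ⟪curl W (secPt d m n τ ξ), d⟫_ℝ = ⟪cross m n, d⟫_ℝ *
      (fderiv ℝ (fun ξ : EuclideanSpace ℝ (Fin 2) => ⟪n, W (secPt d m n τ ξ)⟫_ℝ) ξ (EuclideanSpace.single 0 1) -
        fderiv ℝ (fun ξ : EuclideanSpace ℝ (Fin 2) => ⟪m, W (secPt d m n τ ξ)⟫_ℝ) ξ (EuclideanSpace.single 1 1)) := by
  rw [inner_curl_axis_eq hon, fderiv_inner_comp_secPt_single₀ hW, fderiv_inner_comp_secPt_single₁ hW]

/-- **Master identity for weighted sectional moments of the axial vorticity** (integration by parts in the section): for a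
`C¹` weight `p`, `∫ p ω_d = ε (−∫ (∂₀p) ⟨n, W⟩ + ∫ (∂₁p) ⟨m, W⟩)`. -/
theorem sectional_moment_eq (hon : Orthonormal ℝ ![d, m, n]) (hW : ContDiff ℝ 1 W)
    (hsupp : ∀ y, R ^ 2 ≤ ‖y‖ ^ 2 - ⟪y, d⟫_ℝ ^ 2 → W y = 0) (τ : ℝ) {p : EuclideanSpace ℝ (Fin 2) → ℝ} (hp : ContDiff ℝ 1 p) :
    ∫ ξ, p ξ * ⟪curl W (secPt d m n τ ξ), d⟫_ℝ = ⟪cross m n, d⟫_ℝ *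
      (-(∫ ξ, fderiv ℝ p ξ (EuclideanSpace.single 0 1) * ⟪n, W (secPt d m n τ ξ)⟫_ℝ) +
        ∫ ξ, fderiv ℝ p ξ (EuclideanSpace.single 1 1) * ⟪m, W (secPt d m n τ ξ)⟫_ℝ) := by
  have he : (fun ξ : EuclideanSpace ℝ (Fin 2) => p ξ * ⟪curl W (secPt d m n τ ξ), d⟫_ℝ) = fun ξ => ⟪cross m n, d⟫_ℝ *
      (p ξ * fderiv ℝ (fun ξ : EuclideanSpace ℝ (Fin 2) => ⟪n, W (secPt d m n τ ξ)⟫_ℝ) ξ (EuclideanSpace.single 0 1) -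
        p ξ * fderiv ℝ (fun ξ : EuclideanSpace ℝ (Fin 2) => ⟪m, W (secPt d m n τ ξ)⟫_ℝ) ξ (EuclideanSpace.single 1 1)) := by
    funext ξ; rw [inner_curl_axis_secPt hon hW]; ring
  rw [he, integral_const_mul, integral_sub (integrable_mul_fderiv_inner_comp_secPt hon hW hsupp n τ hp.continuous _)
    (integrable_mul_fderiv_inner_comp_secPt hon hW hsupp m τ hp.continuous _),
    integral_mul_fderiv_apply_eq_neg hp (contDiff_inner_comp_secPt hW n d m n τ) (hasCompactSupport_inner_comp_secPt hon hsupp n τ),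
    integral_mul_fderiv_apply_eq_neg hp (contDiff_inner_comp_secPt hW m d m n τ) (hasCompactSupport_inner_comp_secPt hon hsupp m τ)]
  ring

/-- **THE MASS CLAUSE OF `WaistColumnGateLoc1A` IS AUTOMATIC.**  For every `C¹` field vanishing outside the sectional cylinder of radius
`R` about `ℝd` and every station `τ`, the axial vorticity has zero sectional mass: `∫ ⟨curl W (secPt d m n τ ξ), d⟩ dξ = 0`. -/
theorem axialVorticity_sectionalMass_eq_zero (hon : Orthonormal ℝ ![d, m, n]) (hW : ContDiff ℝ 1 W)
    (hsupp : ∀ y, R ^ 2 ≤ ‖y‖ ^ 2 - ⟪y, d⟫_ℝ ^ 2 → W y = 0) (τ : ℝ) :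
    ∫ ξ : EuclideanSpace ℝ (Fin 2), ⟪curl W (secPt d m n τ ξ), d⟫_ℝ = 0 := by
  have h := sectional_moment_eq hon hW hsupp τ (p := fun _ => (1 : ℝ)) contDiff_const
  simp only [one_mul] at h
  rw [h]
  simp

/-- **First dipole clause = `n`-momentum**: `∫ ξ₀ ω_d = −ε ∫ ⟨n, W⟩`. -/
theorem sectional_dipole₀ (hon : Orthonormal ℝ ![d, m, n]) (hW : ContDiff ℝ 1 W)
    (hsupp : ∀ y, R ^ 2 ≤ ‖y‖ ^ 2 - ⟪y, d⟫_ℝ ^ 2 → W y = 0) (τ : ℝ) :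
    ∫ ξ : EuclideanSpace ℝ (Fin 2), ξ 0 * ⟪curl W (secPt d m n τ ξ), d⟫_ℝ =
      -(⟪cross m n, d⟫_ℝ * ∫ ξ : EuclideanSpace ℝ (Fin 2), ⟪n, W (secPt d m n τ ξ)⟫_ℝ) := by
  rw [sectional_moment_eq hon hW hsupp τ (contDiff_coord 0)]
  simp_rw [fderiv_coord_single]
  simp

/-- **Second dipole clause = `m`-momentum**: `∫ ξ₁ ω_d = ε ∫ ⟨m, W⟩`. -/
theorem sectional_dipole₁ (hon : Orthonormal ℝ ![d, m, n]) (hW : ContDiff ℝ 1 W)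
    (hsupp : ∀ y, R ^ 2 ≤ ‖y‖ ^ 2 - ⟪y, d⟫_ℝ ^ 2 → W y = 0) (τ : ℝ) :
    ∫ ξ : EuclideanSpace ℝ (Fin 2), ξ 1 * ⟪curl W (secPt d m n τ ξ), d⟫_ℝ =
      ⟪cross m n, d⟫_ℝ * ∫ ξ : EuclideanSpace ℝ (Fin 2), ⟪m, W (secPt d m n τ ξ)⟫_ℝ := by
  rw [sectional_moment_eq hon hW hsupp τ (contDiff_coord 1)]
  simp_rw [fderiv_coord_single]
  simp

/-- **The two dipole clauses of `WaistColumnGateLoc1A` hold iff the SECTIONAL MOMENTUM vanishes**: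
`(∫ ξ₀ ω_d = 0 ∧ ∫ ξ₁ ω_d = 0) ↔ (∫⟨m, W⟩ = 0 ∧ ∫⟨n, W⟩ = 0)` at every station. -/
theorem sectional_dipole_iff (hon : Orthonormal ℝ ![d, m, n]) (hW : ContDiff ℝ 1 W)
    (hsupp : ∀ y, R ^ 2 ≤ ‖y‖ ^ 2 - ⟪y, d⟫_ℝ ^ 2 → W y = 0) (τ : ℝ) :
    ((∫ ξ : EuclideanSpace ℝ (Fin 2), ξ 0 * ⟪curl W (secPt d m n τ ξ), d⟫_ℝ) = 0 ∧
        (∫ ξ : EuclideanSpace ℝ (Fin 2), ξ 1 * ⟪curl W (secPt d m n τ ξ), d⟫_ℝ) = 0) ↔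
      ((∫ ξ : EuclideanSpace ℝ (Fin 2), ⟪m, W (secPt d m n τ ξ)⟫_ℝ) = 0 ∧
        (∫ ξ : EuclideanSpace ℝ (Fin 2), ⟪n, W (secPt d m n τ ξ)⟫_ℝ) = 0) := by
  have hε : ⟪cross m n, d⟫_ℝ ≠ 0 := fun h => by
    have := orientationSign_sq hon; rw [h] at this; norm_num at this
  rw [sectional_dipole₀ hon hW hsupp τ, sectional_dipole₁ hon hW hsupp τ, neg_eq_zero, mul_eq_zero, mul_eq_zero]
  constructor
  · rintro ⟨h0, h1⟩
    exact ⟨h1.resolve_left hε, h0.resolve_left hε⟩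
  · rintro ⟨hm, hn⟩
    exact ⟨Or.inr hn, Or.inr hm⟩

/-- **Off-diagonal quadrupole (kinematic form)**: `ε ∫ ξ₀ξ₁ ω_d = ∫ ξ₀ ⟨m, W⟩ − ∫ ξ₁ ⟨n, W⟩`. -/
theorem sectional_quadrupole_xy (hon : Orthonormal ℝ ![d, m, n]) (hW : ContDiff ℝ 1 W)
    (hsupp : ∀ y, R ^ 2 ≤ ‖y‖ ^ 2 - ⟪y, d⟫_ℝ ^ 2 → W y = 0) (τ : ℝ) :
    ⟪cross m n, d⟫_ℝ * ∫ ξ : EuclideanSpace ℝ (Fin 2), ξ 0 * ξ 1 * ⟪curl W (secPt d m n τ ξ), d⟫_ℝ =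
      (∫ ξ : EuclideanSpace ℝ (Fin 2), ξ 0 * ⟪m, W (secPt d m n τ ξ)⟫_ℝ) -
        ∫ ξ : EuclideanSpace ℝ (Fin 2), ξ 1 * ⟪n, W (secPt d m n τ ξ)⟫_ℝ := by
  rw [sectional_moment_eq hon hW hsupp τ ((contDiff_coord 0).mul (contDiff_coord 1))]
  simp_rw [(fderiv_coord_mul _).1, (fderiv_coord_mul _).2]
  have hε := orientationSign_sq hon
  calc ⟪cross m n, d⟫_ℝ * (⟪cross m n, d⟫_ℝ *
        (-(∫ ξ : EuclideanSpace ℝ (Fin 2), ξ 1 * ⟪n, W (secPt d m n τ ξ)⟫_ℝ) +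
          ∫ ξ : EuclideanSpace ℝ (Fin 2), ξ 0 * ⟪m, W (secPt d m n τ ξ)⟫_ℝ))
      = ⟪cross m n, d⟫_ℝ ^ 2 * (-(∫ ξ : EuclideanSpace ℝ (Fin 2), ξ 1 * ⟪n, W (secPt d m n τ ξ)⟫_ℝ) +
          ∫ ξ : EuclideanSpace ℝ (Fin 2), ξ 0 * ⟪m, W (secPt d m n τ ξ)⟫_ℝ) := by ring
    _ = _ := by rw [hε]; ring

/-- **Diagonal quadrupole (kinematic form)**: `ε ∫ (ξ₀² − ξ₁²) ω_d = −2 ∫ ξ₀ ⟨n, W⟩ − 2 ∫ ξ₁ ⟨m, W⟩`. -/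
theorem sectional_quadrupole_xxyy (hon : Orthonormal ℝ ![d, m, n]) (hW : ContDiff ℝ 1 W)
    (hsupp : ∀ y, R ^ 2 ≤ ‖y‖ ^ 2 - ⟪y, d⟫_ℝ ^ 2 → W y = 0) (τ : ℝ) :
    ⟪cross m n, d⟫_ℝ * ∫ ξ : EuclideanSpace ℝ (Fin 2), (ξ 0 ^ 2 - ξ 1 ^ 2) * ⟪curl W (secPt d m n τ ξ), d⟫_ℝ =
      -(2 * ∫ ξ : EuclideanSpace ℝ (Fin 2), ξ 0 * ⟪n, W (secPt d m n τ ξ)⟫_ℝ) -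
        2 * ∫ ξ : EuclideanSpace ℝ (Fin 2), ξ 1 * ⟪m, W (secPt d m n τ ξ)⟫_ℝ := by
  have hp : ContDiff ℝ 1 (fun ξ : EuclideanSpace ℝ (Fin 2) => ξ 0 ^ 2 - ξ 1 ^ 2) :=
    ((contDiff_coord 0).pow 2).sub ((contDiff_coord 1).pow 2)
  rw [sectional_moment_eq hon hW hsupp τ hp]
  simp_rw [(fderiv_coord_sq_sub _).1, (fderiv_coord_sq_sub _).2]
  have h0 : ∫ ξ : EuclideanSpace ℝ (Fin 2), 2 * ξ 0 * ⟪n, W (secPt d m n τ ξ)⟫_ℝ =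
      2 * ∫ ξ : EuclideanSpace ℝ (Fin 2), ξ 0 * ⟪n, W (secPt d m n τ ξ)⟫_ℝ := by
    rw [← integral_const_mul]; congr 1; funext ξ; ring
  have h1 : ∫ ξ : EuclideanSpace ℝ (Fin 2), -(2 * ξ 1) * ⟪m, W (secPt d m n τ ξ)⟫_ℝ =
      -(2 * ∫ ξ : EuclideanSpace ℝ (Fin 2), ξ 1 * ⟪m, W (secPt d m n τ ξ)⟫_ℝ) := by
    rw [← integral_const_mul, ← integral_neg]; congr 1; funext ξ; ring
  rw [h0, h1]
  have hε := orientationSign_sq hon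
  calc ⟪cross m n, d⟫_ℝ * (⟪cross m n, d⟫_ℝ *
        (-(2 * ∫ ξ : EuclideanSpace ℝ (Fin 2), ξ 0 * ⟪n, W (secPt d m n τ ξ)⟫_ℝ) +
          -(2 * ∫ ξ : EuclideanSpace ℝ (Fin 2), ξ 1 * ⟪m, W (secPt d m n τ ξ)⟫_ℝ)))
      = ⟪cross m n, d⟫_ℝ ^ 2 * (-(2 * ∫ ξ : EuclideanSpace ℝ (Fin 2), ξ 0 * ⟪n, W (secPt d m n τ ξ)⟫_ℝ) +
          -(2 * ∫ ξ : EuclideanSpace ℝ (Fin 2), ξ 1 * ⟪m, W (secPt d m n τ ξ)⟫_ℝ)) := by ring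
    _ = _ := by rw [hε]; ring

/-! ### Solenoidal fields: the quadrupole as an axial-streak moment -/

/-- An orthonormal frame `(d; m, n)` is an orthonormal basis of `ℝ³`. -/
theorem exists_orthonormalBasis_frame (hon : Orthonormal ℝ ![d, m, n]) :
    ∃ b : OrthonormalBasis (Fin 3) ℝ (EuclideanSpace ℝ (Fin 3)), ∀ i, b i = ![d, m, n] i := by
  have hcard : Fintype.card (Fin 3) = Module.finrank ℝ (EuclideanSpace ℝ (Fin 3)) := by simp
  have hcoe : ((basisOfOrthonormalOfCardEqFinrank hon hcard : Module.Basis (Fin 3) ℝ (EuclideanSpace ℝ (Fin 3))) : Fin 3 → _) =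
      ![d, m, n] :=
    coe_basisOfOrthonormalOfCardEqFinrank hon hcard
  have hon' : Orthonormal ℝ (basisOfOrthonormalOfCardEqFinrank hon hcard : Module.Basis (Fin 3) ℝ (EuclideanSpace ℝ (Fin 3))) := by
    rw [hcoe]; exact hon
  refine ⟨(basisOfOrthonormalOfCardEqFinrank hon hcard).toOrthonormalBasis hon', fun i => ?_⟩
  have h := congrFun hcoe i
  simp only [Module.Basis.coe_toOrthonormalBasis]
  exact h

/-- **`div W = 0` in the frame**: `⟨d, DW(y) d⟩ = −(⟨m, DW(y) m⟩ + ⟨n, DW(y) n⟩)` (the trace of `DW(y)` in the orthonormal basis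
`(d, m, n)` is the divergence). -/
theorem inner_fderiv_axis_eq_of_isDivFree (hon : Orthonormal ℝ ![d, m, n]) (hdiv : VectorCalculus.IsDivFree W)
    (y : EuclideanSpace ℝ (Fin 3)) :
    ⟪d, fderiv ℝ W y d⟫_ℝ = -(⟪m, fderiv ℝ W y m⟫_ℝ + ⟪n, fderiv ℝ W y n⟫_ℝ) := by
  obtain ⟨b, hb⟩ := exists_orthonormalBasis_frame hon
  have h0 := hdiv y
  rw [VectorCalculus.divergence, LinearMap.trace_eq_sum_inner _ b, Fin.sum_univ_three, hb, hb, hb] at h0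
  simp only [ContinuousLinearMap.coe_coe, Matrix.cons_val_zero, Matrix.cons_val_one, Matrix.cons_val_two, Matrix.head_cons,
    Matrix.tail_cons] at h0
  linarith

/-- **Master identity for weighted moments of the axial derivative of the axial velocity** (solenoidal `W`, `C¹` weight `p`):
`∫ p ⟨d, DW d⟩ dξ = ∫ (∂₀p) ⟨m, W⟩ + ∫ (∂₁p) ⟨n, W⟩`. -/
theorem sectional_axialMoment_eq (hon : Orthonormal ℝ ![d, m, n]) (hW : ContDiff ℝ 1 W) (hdiv : VectorCalculus.IsDivFree W)
    (hsupp : ∀ y, R ^ 2 ≤ ‖y‖ ^ 2 - ⟪y, d⟫_ℝ ^ 2 → W y = 0) (τ : ℝ) {p : EuclideanSpace ℝ (Fin 2) → ℝ} (hp : ContDiff ℝ 1 p) :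
    ∫ ξ, p ξ * ⟪d, fderiv ℝ W (secPt d m n τ ξ) d⟫_ℝ =
      (∫ ξ, fderiv ℝ p ξ (EuclideanSpace.single 0 1) * ⟪m, W (secPt d m n τ ξ)⟫_ℝ) +
        ∫ ξ, fderiv ℝ p ξ (EuclideanSpace.single 1 1) * ⟪n, W (secPt d m n τ ξ)⟫_ℝ := by
  have he : (fun ξ : EuclideanSpace ℝ (Fin 2) => p ξ * ⟪d, fderiv ℝ W (secPt d m n τ ξ) d⟫_ℝ) = fun ξ =>
      -(p ξ * fderiv ℝ (fun ξ : EuclideanSpace ℝ (Fin 2) => ⟪m, W (secPt d m n τ ξ)⟫_ℝ) ξ (EuclideanSpace.single 0 1) +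
        p ξ * fderiv ℝ (fun ξ : EuclideanSpace ℝ (Fin 2) => ⟪n, W (secPt d m n τ ξ)⟫_ℝ) ξ (EuclideanSpace.single 1 1)) := by
    funext ξ
    rw [inner_fderiv_axis_eq_of_isDivFree hon hdiv, fderiv_inner_comp_secPt_single₀ hW, fderiv_inner_comp_secPt_single₁ hW]
    ring
  rw [he, integral_neg, integral_add (integrable_mul_fderiv_inner_comp_secPt hon hW hsupp m τ hp.continuous _)
    (integrable_mul_fderiv_inner_comp_secPt hon hW hsupp n τ hp.continuous _),
    integral_mul_fderiv_apply_eq_neg hp (contDiff_inner_comp_secPt hW m d m n τ) (hasCompactSupport_inner_comp_secPt hon hsupp m τ),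
    integral_mul_fderiv_apply_eq_neg hp (contDiff_inner_comp_secPt hW n d m n τ) (hasCompactSupport_inner_comp_secPt hon hsupp n τ)]
  ring

/-- **THE DIAGONAL QUADRUPOLE OF THE AXIAL VORTICITY IS AN AXIAL-STREAK MOMENT** (solenoidal `W`):
`ε ∫ (ξ₀² − ξ₁²) ⟨curl W, d⟩ dξ = −2 ∫ ξ₀ξ₁ ⟨d, DW(y) d⟩ dξ`.  The right side is (minus twice) the `ξ₀ξ₁`-moment of the AXIAL
DERIVATIVE of the axial velocity: it vanishes for axially constant `W` and is, in general, the `τ`-derivative of a bounded `W_d`-moment —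
NOT zero. -/
theorem sectional_quadrupole_xxyy_eq_axial (hon : Orthonormal ℝ ![d, m, n]) (hW : ContDiff ℝ 1 W)
    (hdiv : VectorCalculus.IsDivFree W) (hsupp : ∀ y, R ^ 2 ≤ ‖y‖ ^ 2 - ⟪y, d⟫_ℝ ^ 2 → W y = 0) (τ : ℝ) :
    ⟪cross m n, d⟫_ℝ * ∫ ξ : EuclideanSpace ℝ (Fin 2), (ξ 0 ^ 2 - ξ 1 ^ 2) * ⟪curl W (secPt d m n τ ξ), d⟫_ℝ =
      -(2 * ∫ ξ : EuclideanSpace ℝ (Fin 2), ξ 0 * ξ 1 * ⟪d, fderiv ℝ W (secPt d m n τ ξ) d⟫_ℝ) := by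
  rw [sectional_quadrupole_xxyy hon hW hsupp τ,
    sectional_axialMoment_eq hon hW hdiv hsupp τ ((contDiff_coord 0).mul (contDiff_coord 1))]
  simp_rw [(fderiv_coord_mul _).1, (fderiv_coord_mul _).2]
  ring

/-- **THE OFF-DIAGONAL QUADRUPOLE OF THE AXIAL VORTICITY IS AN AXIAL-STREAK MOMENT** (solenoidal `W`):
`ε ∫ ξ₀ξ₁ ⟨curl W, d⟩ dξ = ½ ∫ (ξ₀² − ξ₁²) ⟨d, DW(y) d⟩ dξ`. -/
theorem sectional_quadrupole_xy_eq_axial (hon : Orthonormal ℝ ![d, m, n]) (hW : ContDiff ℝ 1 W)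
    (hdiv : VectorCalculus.IsDivFree W) (hsupp : ∀ y, R ^ 2 ≤ ‖y‖ ^ 2 - ⟪y, d⟫_ℝ ^ 2 → W y = 0) (τ : ℝ) :
    ⟪cross m n, d⟫_ℝ * ∫ ξ : EuclideanSpace ℝ (Fin 2), ξ 0 * ξ 1 * ⟪curl W (secPt d m n τ ξ), d⟫_ℝ =
      (1 / 2 : ℝ) * ∫ ξ : EuclideanSpace ℝ (Fin 2), (ξ 0 ^ 2 - ξ 1 ^ 2) * ⟪d, fderiv ℝ W (secPt d m n τ ξ) d⟫_ℝ := by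
  have hp : ContDiff ℝ 1 (fun ξ : EuclideanSpace ℝ (Fin 2) => ξ 0 ^ 2 - ξ 1 ^ 2) :=
    ((contDiff_coord 0).pow 2).sub ((contDiff_coord 1).pow 2)
  rw [sectional_quadrupole_xy hon hW hsupp τ, sectional_axialMoment_eq hon hW hdiv hsupp τ hp]
  simp_rw [(fderiv_coord_sq_sub _).1, (fderiv_coord_sq_sub _).2]
  have h0 : ∫ ξ : EuclideanSpace ℝ (Fin 2), 2 * ξ 0 * ⟪m, W (secPt d m n τ ξ)⟫_ℝ =
      2 * ∫ ξ : EuclideanSpace ℝ (Fin 2), ξ 0 * ⟪m, W (secPt d m n τ ξ)⟫_ℝ := by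
    rw [← integral_const_mul]; congr 1; funext ξ; ring
  have h1 : ∫ ξ : EuclideanSpace ℝ (Fin 2), -(2 * ξ 1) * ⟪n, W (secPt d m n τ ξ)⟫_ℝ =
      -(2 * ∫ ξ : EuclideanSpace ℝ (Fin 2), ξ 1 * ⟪n, W (secPt d m n τ ξ)⟫_ℝ) := by
    rw [← integral_const_mul, ← integral_neg]; congr 1; funext ξ; ring
  rw [h0, h1]
  ring

/-- **Axially frozen solenoidal fields have no sectional quadrupole** — the m = 2 case of the «multipole lever» of
`Theorems/…DefectColumnGateMultipole.lean` in frame-free 3D form: if `DW(y) d = 0` along the section (e.g. `W` constant along `ℝd`), both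
quadrupole moments of the axial vorticity vanish.  In the 3D class of `WaistColumnGateLoc1A` this hypothesis is NOT available. -/
theorem sectional_quadrupole_eq_zero_of_axial (hon : Orthonormal ℝ ![d, m, n]) (hW : ContDiff ℝ 1 W)
    (hdiv : VectorCalculus.IsDivFree W) (hsupp : ∀ y, R ^ 2 ≤ ‖y‖ ^ 2 - ⟪y, d⟫_ℝ ^ 2 → W y = 0) (τ : ℝ)
    (hax : ∀ ξ : EuclideanSpace ℝ (Fin 2), fderiv ℝ W (secPt d m n τ ξ) d = 0) :
    (∫ ξ : EuclideanSpace ℝ (Fin 2), ξ 0 * ξ 1 * ⟪curl W (secPt d m n τ ξ), d⟫_ℝ) = 0 ∧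
      (∫ ξ : EuclideanSpace ℝ (Fin 2), (ξ 0 ^ 2 - ξ 1 ^ 2) * ⟪curl W (secPt d m n τ ξ), d⟫_ℝ) = 0 := by
  have hε : ⟪cross m n, d⟫_ℝ ≠ 0 := fun h => by
    have := orientationSign_sq hon; rw [h] at this; norm_num at this
  have h1 := sectional_quadrupole_xy_eq_axial hon hW hdiv hsupp τ
  have h2 := sectional_quadrupole_xxyy_eq_axial hon hW hdiv hsupp τ
  simp only [hax, inner_zero_right, mul_zero, integral_zero, neg_zero] at h1 h2
  exact ⟨(mul_eq_zero.mp h1).resolve_left hε, (mul_eq_zero.mp h2).resolve_left hε⟩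

end Moments

end Summit.NavierStokesRegularity.NavierStokesRegularity.Theorems.DefectColumnGate

end
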